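import Summits.QuantumAdvantage.AdviceFreeQNC0.CyclicTransfer
import Summits.QuantumAdvantage.AdviceFreeQNC0.AffBells23AntipodalWin
import HarnessLib

/-!
# The antipodal 2-junta, step (ii)(a) of ask P-23h: FOLDING the cycle — the configuration sum over `(x, v)` on the cycle of
# length `h + h` is a twisted cyclic transfer sum over the folded alphabet `Bool × Bool` (qn-prover-3 g13)

For `x v : Fin (h+h) → Bool` (`h = n + 2`) put `X_t = (x_t, x_{t+h})`, `V_t = (v_t, v_{t+h})` (`fold2`; inverse `unfold2`, an
equivalence `foldEquiv`).  The three local data of the antipodal computation —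

* the kernel indicator `[v ∈ K(x)]` (`RingHLF.InKernel`: `v_{b−1} ⊕ v_{b+1} ⊕ x_b v_b = 0` at every `b`),
* the parity twist `Π_b s(x_b)` (`s ≡ 1`, or `s(ξ) = (−1)^{[ξ = 0]}` for the odd-class projector),
* the sign `(−1)^{#{t : x_t ≠ x_{t+h} ∧ v_t ≠ v_{t+h}}}` of `antipodal_rel_iff` —

become a product over `t : Fin h` of one local factor `F s (V_{t−1}) (V_t) (V_{t+1}) (X_t)` in the folded variables, where the
wrap-around neighbours are SWAPPED pairs (`V_{−1} = swap V_{h−1}`, `V_h = swap V_0`; the cyclic index lemmas `unfold2_prv_*`,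
`unfold2_nxt_*`).  Hence (`configSum_eq_cycSum`) the configuration sum `Σ_{x,v} [v ∈ K(x)]·Π s(x_b)·(−1)^{stat}` equals
`Σ_V cycW (G s) swap V` with `G s U V W = Σ_a F s U V W a`, which `CyclicTransfer.sum_cycW_eq` turns into an entry sum of the
`(n+2)`-th power of the `16 × 16` pair-state matrix `M (G s)`.  The identification of `M (G s)` with the tables `Mp1`/`Mm1` and
the count are step (ii)(b) (`AffBells23AntipodalCount.lean`).
WHAT THIS IS NOT: bookkeeping only; separation NOT moved.
-/

namespace Summit.QuantumAdvantage.AdviceFreeQNC0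

namespace AffBells23

open Finset Literature.Computability.QuantumComplexity Literature.Computability.QuantumComplexity.RingHLF CyclicTransfer

variable {n : ℕ}

/-! ### Folding `Fin (h+h) → Bool` into `Fin h → Bool × Bool` (`h = n + 2`) -/

/-- Fold: `X_t = (x_t, x_{t+h})`. -/
def fold2 (x : Fin ((n + 2) + (n + 2)) → Bool) : Fin (n + 2) → Bool × Bool :=
  fun t => (x (Fin.castAdd (n + 2) t), x (Fin.natAdd (n + 2) t))

/-- Unfold: the inverse of `fold2`. -/
def unfold2 (X : Fin (n + 2) → Bool × Bool) : Fin ((n + 2) + (n + 2)) → Bool :=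
  fun b => if hb : b.val < n + 2 then (X ⟨b.val, hb⟩).1 else (X ⟨b.val - (n + 2), by omega⟩).2

/-- `unfold2` on the first half. -/
theorem unfold2_castAdd (X : Fin (n + 2) → Bool × Bool) (t : Fin (n + 2)) :
    unfold2 X (Fin.castAdd (n + 2) t) = (X t).1 := by
  unfold unfold2
  rw [dif_pos (by simp)]
  simp

/-- `unfold2` on the second half. -/
theorem unfold2_natAdd (X : Fin (n + 2) → Bool × Bool) (t : Fin (n + 2)) :
    unfold2 X (Fin.natAdd (n + 2) t) = (X t).2 := by
  unfold unfold2
  rw [dif_neg (by simp)]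
  congr 2
  ext; simp

/-- `fold2 ∘ unfold2 = id`. -/
theorem fold2_unfold2 (X : Fin (n + 2) → Bool × Bool) : fold2 (unfold2 X) = X := by
  funext t
  unfold fold2
  rw [unfold2_castAdd, unfold2_natAdd]

/-- `unfold2 ∘ fold2 = id`. -/
theorem unfold2_fold2 (x : Fin ((n + 2) + (n + 2)) → Bool) : unfold2 (fold2 x) = x := by
  funext b
  unfold unfold2 fold2
  by_cases hb : b.val < n + 2
  · rw [dif_pos hb]
    congr 1
  · rw [dif_neg hb]
    show x (Fin.natAdd (n + 2) ⟨b.val - (n + 2), _⟩) = x b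
    congr 1
    ext
    simp only [Fin.val_natAdd]
    omega

/-- Folding is a bijection. -/
def foldEquiv : (Fin (n + 2) → Bool × Bool) ≃ (Fin ((n + 2) + (n + 2)) → Bool) where
  toFun := unfold2
  invFun := fold2
  left_inv := fold2_unfold2
  right_inv := unfold2_fold2

/-! ### Cyclic neighbours in folded coordinates -/

/-- `v_{b−1}` for `b = t` in the first half. -/
theorem unfold2_prv_castAdd (V : Fin (n + 2) → Bool × Bool) (t : Fin (n + 2)) :
    unfold2 V (prv (Fin.castAdd (n + 2) t)) = (prevV Prod.swap V t).1 := by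
  have ht := t.isLt
  unfold unfold2 prv prevV
  by_cases h0 : t.val = 0
  · rw [dif_pos h0]
    have hval : (Fin.castAdd (n + 2) t).val + ((n + 2) + (n + 2)) - 1 = (n + 2) + (n + 2) - 1 := by
      simp [h0]
    simp only [hval, Nat.mod_eq_of_lt (show (n + 2) + (n + 2) - 1 < (n + 2) + (n + 2) by omega)]
    rw [dif_neg (by omega)]
    simp only [Prod.fst_swap]
    congr 2
    ext
    simp only [Fin.val_last]
    omega
  · rw [dif_neg h0]
    have hval : ((Fin.castAdd (n + 2) t).val + ((n + 2) + (n + 2)) - 1) % ((n + 2) + (n + 2)) = t.val - 1 := by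
      simp only [Fin.val_castAdd]
      rw [show t.val + ((n + 2) + (n + 2)) - 1 = (t.val - 1) + ((n + 2) + (n + 2)) by omega, Nat.add_mod_right,
        Nat.mod_eq_of_lt (by omega)]
    simp only [hval]
    rw [dif_pos (by omega)]

/-- `v_{b+1}` for `b = t` in the first half. -/
theorem unfold2_nxt_castAdd (V : Fin (n + 2) → Bool × Bool) (t : Fin (n + 2)) :
    unfold2 V (nxt (Fin.castAdd (n + 2) t)) = (nextV Prod.swap V t).1 := by
  have ht := t.isLt
  unfold unfold2 nxt nextV
  have hval : ((Fin.castAdd (n + 2) t).val + 1) % ((n + 2) + (n + 2)) = t.val + 1 := by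
    simp only [Fin.val_castAdd]
    exact Nat.mod_eq_of_lt (by omega)
  simp only [hval]
  by_cases h1 : t.val = n + 1
  · rw [dif_neg (by omega), dif_pos h1]
    simp only [Prod.fst_swap]
    congr 2
    ext
    simp [h1]
  · rw [dif_pos (by omega), dif_neg h1]

/-- `v_{b−1}` for `b = t + h` in the second half. -/
theorem unfold2_prv_natAdd (V : Fin (n + 2) → Bool × Bool) (t : Fin (n + 2)) :
    unfold2 V (prv (Fin.natAdd (n + 2) t)) = (prevV Prod.swap V t).2 := by
  have ht := t.isLt
  unfold unfold2 prv prevV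
  have hval : ((Fin.natAdd (n + 2) t).val + ((n + 2) + (n + 2)) - 1) % ((n + 2) + (n + 2)) = (n + 2) + t.val - 1 := by
    simp only [Fin.val_natAdd]
    rw [show (n + 2) + t.val + ((n + 2) + (n + 2)) - 1 = ((n + 2) + t.val - 1) + ((n + 2) + (n + 2)) by omega,
      Nat.add_mod_right, Nat.mod_eq_of_lt (by omega)]
  simp only [hval]
  by_cases h0 : t.val = 0
  · rw [dif_pos (by omega), dif_pos h0]
    simp only [Prod.snd_swap]
    congr 2
    ext
    simp only [Fin.val_last]
    omega
  · rw [dif_neg (by omega), dif_neg h0]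
    congr 2
    ext
    simp only
    omega

/-- `v_{b+1}` for `b = t + h` in the second half. -/
theorem unfold2_nxt_natAdd (V : Fin (n + 2) → Bool × Bool) (t : Fin (n + 2)) :
    unfold2 V (nxt (Fin.natAdd (n + 2) t)) = (nextV Prod.swap V t).2 := by
  have ht := t.isLt
  unfold unfold2 nxt nextV
  by_cases h1 : t.val = n + 1
  · have hval : ((Fin.natAdd (n + 2) t).val + 1) % ((n + 2) + (n + 2)) = 0 := by
      simp only [Fin.val_natAdd, h1]
      rw [show n + 2 + (n + 1) + 1 = (n + 2) + (n + 2) by omega, Nat.mod_self]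
    simp only [hval]
    rw [dif_pos (by omega), dif_pos h1]
    simp only [Prod.snd_swap]
    congr 2
  · have hval : ((Fin.natAdd (n + 2) t).val + 1) % ((n + 2) + (n + 2)) = (n + 2) + t.val + 1 := by
      simp only [Fin.val_natAdd]
      exact Nat.mod_eq_of_lt (by omega)
    simp only [hval]
    rw [dif_neg (by omega), dif_neg h1]
    congr 2
    ext
    simp only
    omega

/-! ### The local factor and the folded weight -/

/-- The two parity twists: `s₊ ≡ 1` and `s₋(ξ) = (−1)^{[ξ = 0]}`. -/
def twist (minus : Bool) (ξ : Bool) : ℤ := if minus then (if ξ then 1 else -1) else 1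

/-- The local factor of rung `t` in folded variables `U = V_{t−1}`, `V = V_t`, `W = V_{t+1}`, `X = X_t`:
kernel equations at `t` and `t + h`, the parity twist of the two coins, and the antipodal sign. -/
def F (minus : Bool) (U V W X : Bool × Bool) : ℤ :=
  (if (xor (xor U.1 W.1) (X.1 && V.1)) = false then 1 else 0) *
    (if (xor (xor U.2 W.2) (X.2 && V.2)) = false then 1 else 0) *
      (twist minus X.1 * twist minus X.2) * (if (X.1 ≠ X.2 ∧ V.1 ≠ V.2) then -1 else 1)

/-- The local factor with the coin pair summed out. -/
def G (minus : Bool) (U V W : Bool × Bool) : ℤ := ∑ X : Bool × Bool, F minus U V W X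

/-- The antipodal statistic `#{t : x_t ≠ x_{t+h} ∧ v_t ≠ v_{t+h}}`. -/
def stat (x v : Fin ((n + 2) + (n + 2)) → Bool) : ℕ :=
  (univ.filter fun t : Fin (n + 2) => x (Fin.castAdd (n + 2) t) ≠ x (Fin.natAdd (n + 2) t) ∧
    v (Fin.castAdd (n + 2) t) ≠ v (Fin.natAdd (n + 2) t)).card

/-- The configuration weight: kernel indicator × parity twist × antipodal sign. -/
def configW (minus : Bool) (x v : Fin ((n + 2) + (n + 2)) → Bool) : ℤ :=
  (if InKernel x v then 1 else 0) * (∏ b : Fin ((n + 2) + (n + 2)), twist minus (x b)) * (-1) ^ stat x v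

/-- The kernel condition in folded coordinates. -/
theorem inKernel_unfold2_iff (X V : Fin (n + 2) → Bool × Bool) :
    InKernel (unfold2 X) (unfold2 V) ↔ ∀ t : Fin (n + 2),
      (xor (xor (prevV Prod.swap V t).1 (nextV Prod.swap V t).1) ((X t).1 && (V t).1)) = false ∧
      (xor (xor (prevV Prod.swap V t).2 (nextV Prod.swap V t).2) ((X t).2 && (V t).2)) = false := by
  unfold InKernel
  constructor
  · intro hK t
    have h1 := hK (Fin.castAdd (n + 2) t)
    have h2 := hK (Fin.natAdd (n + 2) t)
    rw [unfold2_prv_castAdd, unfold2_nxt_castAdd, unfold2_castAdd, unfold2_castAdd] at h1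
    rw [unfold2_prv_natAdd, unfold2_nxt_natAdd, unfold2_natAdd, unfold2_natAdd] at h2
    exact ⟨h1, h2⟩
  · intro hK b
    by_cases hb : b.val < n + 2
    · have e : b = Fin.castAdd (n + 2) ⟨b.val, hb⟩ := by ext; simp
      rw [e, unfold2_prv_castAdd, unfold2_nxt_castAdd, unfold2_castAdd, unfold2_castAdd]
      exact (hK _).1
    · have e : b = Fin.natAdd (n + 2) ⟨b.val - (n + 2), by omega⟩ := by
        ext; simp only [Fin.val_natAdd]; omega
      rw [e, unfold2_prv_natAdd, unfold2_nxt_natAdd, unfold2_natAdd, unfold2_natAdd]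
      exact (hK _).2

/-- **The configuration weight in folded coordinates is the cyclic product of the local factors.** -/
theorem configW_unfold2 (minus : Bool) (X V : Fin (n + 2) → Bool × Bool) :
    configW minus (unfold2 X) (unfold2 V) =
      ∏ t : Fin (n + 2), F minus (prevV Prod.swap V t) (V t) (nextV Prod.swap V t) (X t) := by
  unfold configW
  -- kernel indicator
  have hker : (if InKernel (unfold2 X) (unfold2 V) then (1 : ℤ) else 0) =
      ∏ t : Fin (n + 2), ((if (xor (xor (prevV Prod.swap V t).1 (nextV Prod.swap V t).1) ((X t).1 && (V t).1)) = false
        then (1 : ℤ) else 0) *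
        (if (xor (xor (prevV Prod.swap V t).2 (nextV Prod.swap V t).2) ((X t).2 && (V t).2)) = false then 1 else 0)) := by
    by_cases hK : InKernel (unfold2 X) (unfold2 V)
    · rw [if_pos hK]
      symm
      refine Finset.prod_eq_one fun t _ => ?_
      have ht := (inKernel_unfold2_iff X V).1 hK t
      rw [if_pos ht.1, if_pos ht.2, one_mul]
    · rw [if_neg hK]
      have hex : ∃ t : Fin (n + 2),
          ¬ ((xor (xor (prevV Prod.swap V t).1 (nextV Prod.swap V t).1) ((X t).1 && (V t).1)) = false ∧
            (xor (xor (prevV Prod.swap V t).2 (nextV Prod.swap V t).2) ((X t).2 && (V t).2)) = false) := by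
        by_contra hne
        push Not at hne
        exact hK ((inKernel_unfold2_iff X V).2 fun t => hne t)
      obtain ⟨t, ht⟩ := hex
      symm
      apply Finset.prod_eq_zero (mem_univ t)
      by_cases h1 : (xor (xor (prevV Prod.swap V t).1 (nextV Prod.swap V t).1) ((X t).1 && (V t).1)) = false
      · have h2 : ¬ (xor (xor (prevV Prod.swap V t).2 (nextV Prod.swap V t).2) ((X t).2 && (V t).2)) = false :=
          fun h2 => ht ⟨h1, h2⟩
        rw [if_neg h2, mul_zero]
      · rw [if_neg h1, zero_mul]
  -- parity twist
  have htw : (∏ b : Fin ((n + 2) + (n + 2)), twist minus (unfold2 X b)) =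
      ∏ t : Fin (n + 2), (twist minus (X t).1 * twist minus (X t).2) := by
    rw [Fin.prod_univ_add, ← Finset.prod_mul_distrib]
    refine Finset.prod_congr rfl fun t _ => ?_
    rw [unfold2_castAdd, unfold2_natAdd]
  -- antipodal sign
  have hsg : ((-1 : ℤ) ^ stat (unfold2 X) (unfold2 V)) =
      ∏ t : Fin (n + 2), (if ((X t).1 ≠ (X t).2 ∧ (V t).1 ≠ (V t).2) then (-1 : ℤ) else 1) := by
    unfold stat
    rw [← Finset.prod_filter, Finset.prod_const]
    congr 1
    congr 1
    refine filter_congr fun t _ => ?_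
    rw [unfold2_castAdd, unfold2_natAdd, unfold2_castAdd, unfold2_natAdd]
  rw [hker, htw, hsg, ← Finset.prod_mul_distrib, ← Finset.prod_mul_distrib]
  refine Finset.prod_congr rfl fun t _ => ?_
  unfold F
  ring

/-- **The configuration sum is a twisted cyclic transfer sum.** -/
theorem configSum_eq_cycSum (minus : Bool) :
    ∑ x : Fin ((n + 2) + (n + 2)) → Bool, ∑ v : Fin ((n + 2) + (n + 2)) → Bool, configW minus x v =
      ∑ V : Fin (n + 2) → Bool × Bool, cycW (G minus) Prod.swap V := by
  rw [← Fintype.sum_equiv foldEquiv (fun X => ∑ v, configW minus (unfold2 X) v) _ (fun X => rfl)]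
  have e : ∀ X : Fin (n + 2) → Bool × Bool, (∑ v : Fin ((n + 2) + (n + 2)) → Bool, configW minus (unfold2 X) v) =
      ∑ V : Fin (n + 2) → Bool × Bool, configW minus (unfold2 X) (unfold2 V) := fun X =>
    (Fintype.sum_equiv foldEquiv (fun V => configW minus (unfold2 X) (unfold2 V)) _ (fun V => rfl)).symm
  simp_rw [e, configW_unfold2]
  rw [Finset.sum_comm]
  refine Finset.sum_congr rfl fun V _ => ?_
  unfold cycW G
  rw [Fintype.prod_sum]

/-- **The configuration sum as a matrix-power entry sum** (with `CyclicTransfer.sum_cycW_eq`). -/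
theorem configSum_eq_powSum (minus : Bool) :
    ∑ x : Fin ((n + 2) + (n + 2)) → Bool, ∑ v : Fin ((n + 2) + (n + 2)) → Bool, configW minus x v =
      ∑ b : Bool × Bool, ∑ c : Bool × Bool, (M (G minus) ^ (n + 2)) (Prod.swap c, b) (c, Prod.swap b) := by
  rw [configSum_eq_cycSum, sum_cycW_eq]

end AffBells23

end Summit.QuantumAdvantage.AdviceFreeQNC0
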